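import Mathlib
import Summits.Langlands.Langlands.Theses.QuarterDeficit1951
import Literature.NumberTheory.Automorphic.CertifiedMaassHeckeTraceCensus

/-!
# Sketch — crux idea `neighbour-multiplicity-kill` for `CensusDeficit1951` (stmt-Langlands-17933)

First lemma of the idea card (crux-ideate round 1, ideator 1): the v1 census format decides the
crux only through its UPPER COUNT `U = ⌊m1hi/hlo⌋`; two DISTINCT cuspidal Laplace eigenvalues in
the window `|λ − 1/4| ≤ 1/100` of ONE order-5 character space (parity irrelevant, Hecke data
irrelevant) force `U ≥ 2` for every certified transcript, hence kill `certifiesDeficit` and with it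
the crux.  This is the contrapositive of the refuter's hidden strengthening
("deficit ⇒ window multiplicity ≤ 1 per χ"), turned into an attack: a NEIGHBOUR SIGHTING.

Everything here is proved (no `sorry`); the decoding lemmas used are the landed
`MaassHeckeTraceCensus.not_inWindow_of_upperCount_eq_zero` /
`MaassHeckeTraceCensus.window_subsingleton_of_upperCount_eq_one` and the completeness clause of
`IsJointSpectralData.exists_eigenbasis`.
-/

set_option linter.dupNamespace false -- project-wide: `Summit.Langlands.Langlands` is the mandated namespace

namespace Summit.Langlands.Langlands.Cruxes.CensusDeficit1951.NeighbourMultiplicityKill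

open Literature.NumberTheory.Automorphic
open Summit.Langlands.Langlands.Theses.QuarterDeficit1951

/-- **Neighbour sighting** — the certificate shape of the idea: for some order-5 character `χ`
mod 1951, two non-zero weight-0 Maass cusp forms on `(Γ₀(1951), χ)` (in the census' own
vocabulary `IsMaassCuspFormOn`) with DIFFERENT Laplace eigenvalues, both in the window
`|λ − 1/4| ≤ 1/100`.  In practice: the sighted odd `r = 0` icosahedral newform plus one generic
(even or odd) cusp form with `0 < r ≤ 1/10`, each with a certified eigenvalue enclosure, the two
enclosures disjoint.  No Hecke eigenvalue, no fingerprint, no parity enters. -/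
def NeighbourSighting : Prop :=
  ∃ χ : DirichletCharacter ℂ 1951, orderOf χ = 5 ∧
    ∃ (u₁ u₂ : UpperHalfPlane → ℂ) (l₁ l₂ : ℝ),
      IsMaassCuspFormOn 1951 χ u₁ l₁ ∧ IsMaassCuspFormOn 1951 χ u₂ l₂ ∧
      (∃ z, u₁ z ≠ 0) ∧ (∃ z, u₂ z ≠ 0) ∧ l₁ ≠ l₂ ∧
      |l₁ - 1 / 4| ≤ 1 / 100 ∧ |l₂ - 1 / 4| ≤ 1 / 100

/-- A non-zero Maass cusp form of eigenvalue `l` forces a line of eigenvalue `l` in any joint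
spectral data (completeness clause of `IsJointSpectralData`). -/
theorem exists_line_of_cuspForm {N : ℕ} {χ : DirichletCharacter ℂ N} {P : Finset ℕ} {J : Type*}
    {d : J → MaassHeckeTraceCensus.SpectralLine}
    (hJ : MaassHeckeTraceCensus.IsJointSpectralData N χ P d)
    {u : UpperHalfPlane → ℂ} {l : ℝ} (hu : IsMaassCuspFormOn N χ u l) (hne : ∃ z, u z ≠ 0) :
    ∃ j, (d j).lam = l := by
  obtain ⟨ub, -, -, -, hspan⟩ := hJ.exists_eigenbasis
  by_contra hno
  push Not at hno
  have hempty : {j | (d j).lam = l} = (∅ : Set J) := by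
    ext j
    simp [hno j]
  have hmem := hspan u l hu
  rw [hempty, Set.image_empty, Submodule.span_empty] at hmem
  have hu0 : u = 0 := (Submodule.mem_bot ℂ).mp hmem
  obtain ⟨z, hz⟩ := hne
  exact hz (by simp [hu0])

/-- **First lemma (PROVED): a neighbour sighting refutes the crux.**  Two distinct window
eigenvalues in one order-5 character space make every certified v1 transcript for that `χ` have
`upperCount ≥ 2` (by `not_inWindow_of_upperCount_eq_zero` and
`window_subsingleton_of_upperCount_eq_one`), so its `certifiesDeficit` is `false`; the crux asks for
such a transcript for EVERY order-5 `χ`. -/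
theorem not_censusDeficit1951_of_neighbourSighting (h : NeighbourSighting) :
    ¬ CensusDeficit1951 := by
  rintro hD
  obtain ⟨χ, hχ, u₁, u₂, l₁, l₂, hu₁, hu₂, hne₁, hne₂, hl, hw₁, hw₂⟩ := h
  obtain ⟨c, hwin, -, -, hc, hv⟩ := hD χ hχ
  unfold CertifiedMaassHeckeTraceCensus at hc
  obtain ⟨-, hw, J, d, hJ, hE⟩ := hc
  obtain ⟨j₁, hj₁⟩ := exists_line_of_cuspForm hJ hu₁ hne₁
  obtain ⟨j₂, hj₂⟩ := exists_line_of_cuspForm hJ hu₂ hne₂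
  have hjne : j₁ ≠ j₂ := by
    rintro rfl
    exact hl (hj₁.symm.trans hj₂)
  have hwin' : (1 / 100 : ℝ) ≤ (c.window : ℝ) := by
    have := (Rat.cast_le (K := ℝ)).mpr hwin
    push_cast at this
    exact this
  have hin₁ : c.inWindow (d j₁).lam := by
    rw [MaassHeckeTraceCensus.inWindow, hj₁]; exact hw₁.trans hwin'
  have hin₂ : c.inWindow (d j₂).lam := by
    rw [MaassHeckeTraceCensus.inWindow, hj₂]; exact hw₂.trans hwin'
  unfold MaassHeckeTraceCensus.certifiesDeficit at hv
  simp only [Bool.and_eq_true, Bool.or_eq_true, beq_iff_eq] at hv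
  obtain ⟨-, hU | ⟨hU, -⟩⟩ := hv
  · exact MaassHeckeTraceCensus.not_inWindow_of_upperCount_eq_zero hJ hE hw hU j₁ hin₁
  · exact hjne (MaassHeckeTraceCensus.window_subsingleton_of_upperCount_eq_one hJ hE hw hU hin₁ hin₂)

/-- The same statement with the census window made explicit as a hypothesis-free corollary in the
form a crux-plan skeleton would register (`stub_neighbourSighting : NeighbourSighting` is the one
computation-class stub; the composition is this theorem). -/
theorem censusDeficit1951_false_of_neighbour :
    NeighbourSighting → ¬ CensusDeficit1951 :=
  not_censusDeficit1951_of_neighbourSighting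

end Summit.Langlands.Langlands.Cruxes.CensusDeficit1951.NeighbourMultiplicityKill
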